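import Literature.NumberTheory.ModularForms.JacobiThetaGammaTwo
import Mathlib.Analysis.Complex.BranchLogRoot
import Mathlib.Analysis.Complex.CoveringMap
import Mathlib.Analysis.Convex.Contractible
import Mathlib.Analysis.SpecialFunctions.Complex.LogDeriv
import HarnessLib

/-!
# The holomorphic logarithms `𝓛 = log λ` and `𝓛_S = log(1 − λ)` of CKMRV §2.1.3

Cohn–Kumar–Miller–Radchenko–Viazovska, Ann. of Math. 196 (2022) = arXiv:1902.05438, §2.1.3:
"The nonvanishing of `λ` and `λ_S` on `ℍ` allows us to define `𝓛(z) = ∫₀^z λ′(w)/λ(w) dw` and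
`𝓛_S(z) = −∫_z^∞ λ_S′(w)/λ_S(w) dw` … These functions satisfy `𝓛(it) = log(λ(it))` and
`𝓛_S(it) = log(λ_S(it)) = log(1 − λ(it))` for `t > 0`, and as such are holomorphic functions for
which `e^𝓛 = λ` and `e^{𝓛_S} = λ_S`", with (2.8) `λ_S(z) = λ(−1/z) = 1 − λ(z)` and the
transformation properties (2.11)
`𝓛|₀T = 𝓛 − 𝓛_S + iπ`, `𝓛_S|₀T = −𝓛_S`, `𝓛|₀S = 𝓛_S`, `𝓛_S|₀S = 𝓛`.

We DEFINE `logLambda = 𝓛` and `logLambdaS = 𝓛_S` as the holomorphic logarithms of `λ` and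
`1 − λ` on `ℍ` that are real on the imaginary axis (equivalently — by uniqueness of continuous
logarithms on the connected `ℍ` — CKMRV's contour integrals), and PROVE: existence and
holomorphy (`Complex.exists_continuousOn_eqOn_exp_comp` on the simply connected `ℍ`, and a
continuous logarithm of a holomorphic function is holomorphic), `e^𝓛 = λ`, `e^{𝓛_S} = 1 − λ`,
`𝓛(it) = log λ(it)`, `𝓛_S(it) = log(1 − λ(it))`, the four laws (2.11), and the limits
`𝓛_S(τ) → 0`, `𝓛(τ) − πiτ → log 16` as `Im τ → ∞` (the constant terms of (2.10)).

## References

* H. Cohn, A. Kumar, S. D. Miller, D. Radchenko, M. Viazovska, Ann. of Math. 196 (2022),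
  arXiv:1902.05438, §2.1.3, displays (2.8)–(2.11). [CohnEtAl2019]
-/

noncomputable section

open Complex hiding I
open Filter Topology ModularForm SlashInvariantForm Set
open UpperHalfPlane hiding I
open Complex (I)
open scoped Real MatrixGroups ModularForm Manifold

namespace Literature.NumberTheory.ModularForms

open Literature.NumberTheory.EllipticCurves.JacobiThetaNull

/-! ## Continuous and holomorphic logarithms -/

/-- **Uniqueness of continuous logarithms**: two continuous logarithms of the same function on a
preconnected set that agree at one point agree (lifting through the covering `exp : ℂ → ℂ∖{0}`).
[folklore] -/
theorem eqOn_of_cexp_eq {α : Type*} [TopologicalSpace α] {s : Set α} (hs : IsPreconnected s)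
    {g₁ g₂ : α → ℂ} (h₁ : ContinuousOn g₁ s) (h₂ : ContinuousOn g₂ s)
    (he : ∀ a ∈ s, cexp (g₁ a) = cexp (g₂ a)) {a : α} (has : a ∈ s) (ha : g₁ a = g₂ a) :
    s.EqOn g₁ g₂ :=
  Complex.isCoveringMap_exp.eqOn_of_comp_eqOn hs h₁ h₂ (fun x hx => Subtype.ext (he x hx)) has ha

/-- **A continuous logarithm of a holomorphic function is holomorphic.** [folklore] -/
theorem differentiableOn_of_cexp_eq {U : Set ℂ} {f g : ℂ → ℂ} (hf : ContinuousOn f U)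
    (hg : DifferentiableOn ℂ g U) (he : ∀ z ∈ U, cexp (f z) = g z) : DifferentiableOn ℂ f U := by
  intro z₀ hz₀
  set w₀ := f z₀ with hw₀
  -- near `z₀` (within `U`), `f = w₀ + log (g · e^{−w₀})` with the principal branch
  have key : ∀ᶠ z in 𝓝[U] z₀, f z = w₀ + Complex.log (g z * cexp (-w₀)) := by
    have hc : ContinuousWithinAt (fun z => f z - w₀) U z₀ :=
      (hf z₀ hz₀).sub continuousWithinAt_const
    have hsmall : ∀ᶠ z in 𝓝[U] z₀, ‖f z - w₀‖ < π := by
      have ht := hc.tendsto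
      rw [show f z₀ - w₀ = 0 by simp [hw₀]] at ht
      have := ht (Metric.ball_mem_nhds (0 : ℂ) Real.pi_pos)
      filter_upwards [this] with z hz
      simpa using hz
    filter_upwards [hsmall, self_mem_nhdsWithin] with z hz hzU
    have him : |(f z - w₀).im| < π := (abs_im_le_norm _).trans_lt hz
    have hprod : g z * cexp (-w₀) = cexp (f z - w₀) := by
      rw [sub_eq_add_neg, Complex.exp_add, he z hzU]
    rw [hprod, Complex.log_exp (by linarith [neg_abs_le (f z - w₀).im])
      (by linarith [le_abs_self (f z - w₀).im])]
    ring
  have hd : DifferentiableWithinAt ℂ (fun z => w₀ + Complex.log (g z * cexp (-w₀))) U z₀ := by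
    refine (differentiableWithinAt_const _).add (((hg z₀ hz₀).mul
      (differentiableWithinAt_const _)).clog ?_)
    change g z₀ * cexp (-w₀) ∈ slitPlane
    rw [show g z₀ * cexp (-w₀) = 1 by
      rw [← he z₀ hz₀, ← Complex.exp_add, add_neg_cancel, Complex.exp_zero]]
    exact one_mem_slitPlane
  exact hd.congr_of_eventuallyEq key (key.self_of_nhdsWithin hz₀)

/-- The open upper half-plane in `ℂ` is simply connected (it is convex). [folklore] -/
theorem isSimplyConnected_upperHalfPlaneSet : IsSimplyConnected {z : ℂ | 0 < z.im} := by
  have : ContractibleSpace {z : ℂ | 0 < z.im} :=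
    (convex_halfSpace_im_gt 0).contractibleSpace ⟨Complex.I, by simp⟩
  exact SimplyConnectedSpace.ofContractible _

/-- `ofComplex` is continuous on the open upper half-plane. [folklore] -/
theorem continuousOn_ofComplex : ContinuousOn ofComplex {z : ℂ | 0 < z.im} := by
  refine ofComplex.continuousOn.mono fun z hz => ?_
  have : z ∈ Set.range ((↑) : ℍ → ℂ) := ⟨⟨z, hz⟩, rfl⟩
  simpa [ofComplex] using this

/-- **Existence of continuous logarithms on `ℍ`**: a continuous nowhere-vanishing `F : ℍ → ℂ` has a
continuous logarithm. [folklore] -/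
theorem exists_continuous_cexp_eq {F : ℍ → ℂ} (hc : Continuous F) (h0 : ∀ τ, F τ ≠ 0) :
    ∃ L : ℍ → ℂ, Continuous L ∧ ∀ τ, cexp (L τ) = F τ := by
  have hg : ContinuousOn (F ∘ ofComplex) {z : ℂ | 0 < z.im} := hc.comp_continuousOn continuousOn_ofComplex
  have hU0 : (0 : ℂ) ∉ (F ∘ ofComplex) '' {z : ℂ | 0 < z.im} := by
    rintro ⟨z, -, hz⟩
    exact h0 _ hz
  obtain ⟨f, hf, hfe⟩ := Complex.exists_continuousOn_eqOn_exp_comp isSimplyConnected_upperHalfPlaneSet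
    (isOpen_lt continuous_const Complex.continuous_im) hg hU0
  refine ⟨fun τ => f τ, hf.comp_continuous continuous_coe fun τ => τ.im_pos, fun τ => ?_⟩
  have := hfe (show ((τ : ℂ)) ∈ {z : ℂ | 0 < z.im} from τ.im_pos)
  simpa [ofComplex_apply] using this

/-- **A continuous logarithm of a holomorphic function on `ℍ` is holomorphic.** [folklore] -/
theorem mdifferentiable_of_cexp_eq {F L : ℍ → ℂ} (hF : MDiff F) (hL : Continuous L)
    (he : ∀ τ, cexp (L τ) = F τ) : MDiff L := by
  rw [UpperHalfPlane.mdifferentiable_iff] at hF ⊢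
  refine differentiableOn_of_cexp_eq (hL.comp_continuousOn continuousOn_ofComplex) hF fun z hz => ?_
  simp [Function.comp_apply, he]

/-! ## Connectedness in `ℍ` -/

/-- The range of `ℍ → ℂ` is the open upper half-plane. [folklore] -/
theorem range_coe_upperHalfPlane : Set.range ((↑) : ℍ → ℂ) = {z : ℂ | 0 < z.im} := by
  ext z
  exact ⟨fun ⟨τ, hτ⟩ => hτ ▸ τ.im_pos, fun hz => ⟨⟨z, hz⟩, rfl⟩⟩

/-- `ℍ` is preconnected. [folklore] -/
theorem isPreconnected_univ_upperHalfPlane : IsPreconnected (Set.univ : Set ℍ) := by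
  rw [← isEmbedding_coe.isInducing.isPreconnected_image, image_univ, range_coe_upperHalfPlane]
  exact (convex_halfSpace_im_gt 0).isPreconnected

/-- `ℍ` is a preconnected space. [folklore] -/
instance : PreconnectedSpace ℍ := ⟨isPreconnected_univ_upperHalfPlane⟩

/-- The half-planes `{Im τ ≥ T}` are preconnected. [folklore] -/
theorem isPreconnected_setOf_le_im (T : ℝ) : IsPreconnected {τ : ℍ | T ≤ τ.im} := by
  rw [← isEmbedding_coe.isInducing.isPreconnected_image]
  have : ((↑) : ℍ → ℂ) '' {τ : ℍ | T ≤ τ.im} = {z : ℂ | T ≤ z.im} ∩ {z : ℂ | 0 < z.im} := by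
    ext z
    constructor
    · rintro ⟨τ, hτ, rfl⟩
      exact ⟨hτ, τ.im_pos⟩
    · rintro ⟨h1, h2⟩
      exact ⟨⟨z, h2⟩, h1, rfl⟩
  rw [this]
  exact ((convex_halfSpace_im_ge T).inter (convex_halfSpace_im_gt 0)).isPreconnected

/-- The point `it ∈ ℍ` for `t > 0`. [folklore] -/
def mkI (t : ℝ) (ht : 0 < t) : ℍ := ⟨Complex.I * t, by simpa using ht⟩

/-- `↑(it) = it`. [folklore] -/
@[simp] theorem coe_mkI (t : ℝ) (ht : 0 < t) : ((mkI t ht : ℍ) : ℂ) = Complex.I * t := rfl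

/-- `Im(it) = t`. [folklore] -/
@[simp] theorem mkI_im (t : ℝ) (ht : 0 < t) : (mkI t ht).im = t := by
  simp [UpperHalfPlane.im, mkI]

/-- `Re(it) = 0`. [folklore] -/
@[simp] theorem mkI_re (t : ℝ) (ht : 0 < t) : (mkI t ht).re = 0 := by
  simp [UpperHalfPlane.re, mkI]

/-- `mkI 1 = i`. [folklore] -/
theorem mkI_one : mkI 1 one_pos = UpperHalfPlane.I := by
  apply UpperHalfPlane.ext; simp [mkI]

/-- A point of the imaginary axis is `it` with `t = Im τ`. [folklore] -/
theorem eq_mkI_of_re_eq_zero {τ : ℍ} (h : τ.re = 0) : τ = mkI τ.im τ.im_pos := by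
  apply UpperHalfPlane.ext
  apply Complex.ext
  · simpa [mkI] using h
  · simp [mkI]

/-- The imaginary axis `{it : t > 0}` of `ℍ` is preconnected. [folklore] -/
theorem isPreconnected_imagAxis : IsPreconnected {τ : ℍ | τ.re = 0} := by
  have hset : {τ : ℍ | τ.re = 0} = (ofComplex ∘ fun t : ℝ => Complex.I * t) '' Set.Ioi 0 := by
    ext τ
    simp only [mem_setOf_eq, mem_image, mem_Ioi, Function.comp_apply]
    constructor
    · intro h
      refine ⟨τ.im, τ.im_pos, ?_⟩
      rw [ofComplex_apply_of_im_pos (by simpa using τ.im_pos)]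
      exact (eq_mkI_of_re_eq_zero h).symm
    · rintro ⟨t, ht, rfl⟩
      rw [ofComplex_apply_of_im_pos (by simpa using ht)]
      simp [UpperHalfPlane.re]
  rw [hset]
  refine isPreconnected_Ioi.image _ (continuousOn_ofComplex.comp (by fun_prop) fun t ht => ?_)
  simpa using ht

/-! ## `λ` on `ℍ`: holomorphy, the imaginary axis, the value `λ(i) = 1/2` -/

/-- `λ` is holomorphic on `ℍ`. [folklore] -/
theorem mdifferentiable_modularLambda : MDiff modularLambda := by
  rw [UpperHalfPlane.mdifferentiable_iff]
  have hV := UpperHalfPlane.mdifferentiable_iff.mp mdifferentiable_thetaV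
  have hU := UpperHalfPlane.mdifferentiable_iff.mp mdifferentiable_thetaU
  exact hV.div hU fun z _ => thetaU_ne_zero _

/-- `λ` is continuous on `ℍ`. [folklore] -/
theorem continuous_modularLambda : Continuous modularLambda :=
  mdifferentiable_modularLambda.continuous

/-- `λ(it) = θ₂(it)⁴/θ₃(it)⁴` is real. [folklore] -/
theorem modularLambda_mkI (t : ℝ) (ht : 0 < t) :
    modularLambda (mkI t ht) = (((theta2 (Complex.I * t)).re ^ 4 / (theta3 (Complex.I * t)).re ^ 4 : ℝ) : ℂ) := by
  rw [modularLambda, thetaV_apply, thetaU_apply, coe_mkI, theta2_I_mul_eq_re ht, theta3_I_mul_eq_re ht]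
  push_cast
  simp

/-- `0 < λ(it) < 1` (the elliptic modulus). [folklore] -/
theorem modularLambda_mkI_re_mem (t : ℝ) (ht : 0 < t) :
    (modularLambda (mkI t ht)).re ∈ Set.Ioo (0 : ℝ) 1 := by
  rw [modularLambda_mkI t ht, ofReal_re]
  exact theta2_div_theta3_pow_four_mem_Ioo ht

/-- `λ(it)` is real: `λ(it) = Re λ(it)`. [folklore] -/
theorem modularLambda_mkI_eq_re (t : ℝ) (ht : 0 < t) :
    modularLambda (mkI t ht) = ((modularLambda (mkI t ht)).re : ℂ) := by
  conv_lhs => rw [modularLambda_mkI t ht]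
  rw [modularLambda_mkI t ht, ofReal_re]

/-- On the imaginary axis `λ` is real with `0 < λ < 1`. [folklore] -/
theorem modularLambda_eq_re_of_re_eq_zero {τ : ℍ} (h : τ.re = 0) :
    modularLambda τ = ((modularLambda τ).re : ℂ) ∧ (modularLambda τ).re ∈ Set.Ioo (0 : ℝ) 1 := by
  rw [eq_mkI_of_re_eq_zero h]
  exact ⟨modularLambda_mkI_eq_re _ _, modularLambda_mkI_re_mem _ _⟩

/-- **`λ(i) = 1/2`** (`λ(−1/τ) = 1 − λ(τ)` at the fixed point `i` of `S`). [folklore] -/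
theorem modularLambda_I : modularLambda UpperHalfPlane.I = 1 / 2 := by
  have hSI : ModularGroup.S • UpperHalfPlane.I = UpperHalfPlane.I := by
    rw [modular_S_smul]; apply UpperHalfPlane.ext; simp
  have h := modularLambda_neg_inv UpperHalfPlane.I
  rw [← modular_S_smul, hSI] at h
  linear_combination h / 2

/-! ## The logarithms `𝓛` and `𝓛_S` -/

/-- Existence of the normalised logarithm of `λ`. [folklore] -/
theorem exists_logLambda : ∃ L : ℍ → ℂ, Continuous L ∧ (∀ τ, cexp (L τ) = modularLambda τ) ∧
    L UpperHalfPlane.I = (Real.log (1 / 2) : ℝ) := by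
  obtain ⟨L₀, hL₀, he⟩ := exists_continuous_cexp_eq continuous_modularLambda modularLambda_ne_zero
  refine ⟨fun τ => L₀ τ + ((Real.log (1 / 2) : ℝ) - L₀ UpperHalfPlane.I), by fun_prop, fun τ => ?_,
    by ring⟩
  rw [Complex.exp_add, he, Complex.exp_sub, he, modularLambda_I, ← Complex.ofReal_exp,
    Real.exp_log (by norm_num)]
  push_cast
  field_simp

/-- Existence of the normalised logarithm of `λ_S = 1 − λ`. [folklore] -/
theorem exists_logLambdaS : ∃ L : ℍ → ℂ, Continuous L ∧ (∀ τ, cexp (L τ) = 1 - modularLambda τ) ∧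
    L UpperHalfPlane.I = (Real.log (1 / 2) : ℝ) := by
  obtain ⟨L₀, hL₀, he⟩ := exists_continuous_cexp_eq (F := fun τ => 1 - modularLambda τ)
    (continuous_const.sub continuous_modularLambda) fun τ => sub_ne_zero.2 (modularLambda_ne_one τ).symm
  refine ⟨fun τ => L₀ τ + ((Real.log (1 / 2) : ℝ) - L₀ UpperHalfPlane.I), by fun_prop, fun τ => ?_,
    by ring⟩
  rw [Complex.exp_add, he, Complex.exp_sub, he, modularLambda_I, ← Complex.ofReal_exp,
    Real.exp_log (by norm_num)]
  push_cast
  field_simp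
  ring

/-- **`𝓛 = log λ`** (CKMRV §2.1.3): the holomorphic logarithm of `λ` on `ℍ` with
`𝓛(it) = log λ(it)` real for `t > 0` (normalised here at `i`, `𝓛(i) = log ½`; the two
normalisations agree, `logLambda_mkI`). [cite: CohnEtAl2019, §2.1.3] -/
def logLambda : ℍ → ℂ := Classical.choose exists_logLambda

/-- **`𝓛_S = log λ_S = log(1 − λ)`** (CKMRV §2.1.3): the holomorphic logarithm of `1 − λ` on `ℍ`
with `𝓛_S(it) = log(1 − λ(it))` real for `t > 0`. [cite: CohnEtAl2019, §2.1.3] -/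
def logLambdaS : ℍ → ℂ := Classical.choose exists_logLambdaS

/-- `𝓛` is continuous. [folklore] -/
theorem continuous_logLambda : Continuous logLambda := (Classical.choose_spec exists_logLambda).1

/-- **`e^𝓛 = λ`.** [cite: CohnEtAl2019, §2.1.3] -/
theorem cexp_logLambda (τ : ℍ) : cexp (logLambda τ) = modularLambda τ :=
  (Classical.choose_spec exists_logLambda).2.1 τ

/-- `𝓛(i) = log ½`. [folklore] -/
theorem logLambda_I : logLambda UpperHalfPlane.I = (Real.log (1 / 2) : ℝ) :=
  (Classical.choose_spec exists_logLambda).2.2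

/-- `𝓛_S` is continuous. [folklore] -/
theorem continuous_logLambdaS : Continuous logLambdaS := (Classical.choose_spec exists_logLambdaS).1

/-- **`e^{𝓛_S} = λ_S = 1 − λ`.** [cite: CohnEtAl2019, §2.1.3] -/
theorem cexp_logLambdaS (τ : ℍ) : cexp (logLambdaS τ) = 1 - modularLambda τ :=
  (Classical.choose_spec exists_logLambdaS).2.1 τ

/-- `𝓛_S(i) = log ½`. [folklore] -/
theorem logLambdaS_I : logLambdaS UpperHalfPlane.I = (Real.log (1 / 2) : ℝ) :=
  (Classical.choose_spec exists_logLambdaS).2.2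

/-- **`𝓛` is holomorphic.** [cite: CohnEtAl2019, §2.1.3] -/
theorem mdifferentiable_logLambda : MDiff logLambda :=
  mdifferentiable_of_cexp_eq mdifferentiable_modularLambda continuous_logLambda cexp_logLambda

/-- **`𝓛_S` is holomorphic.** [cite: CohnEtAl2019, §2.1.3] -/
theorem mdifferentiable_logLambdaS : MDiff logLambdaS :=
  mdifferentiable_of_cexp_eq (mdifferentiable_const.sub mdifferentiable_modularLambda)
    continuous_logLambdaS cexp_logLambdaS

/-- `i` lies on the imaginary axis. [folklore] -/
theorem I_re : UpperHalfPlane.I.re = 0 := by simp [UpperHalfPlane.re]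

/-- **`𝓛(it) = log λ(it)`** for `t > 0` (real logarithm). [cite: CohnEtAl2019, §2.1.3] -/
theorem logLambda_of_re_eq_zero {τ : ℍ} (h : τ.re = 0) :
    logLambda τ = (Real.log (modularLambda τ).re : ℝ) := by
  have key : Set.EqOn logLambda (fun τ => ((Real.log (modularLambda τ).re : ℝ) : ℂ)) {τ : ℍ | τ.re = 0} := by
    refine eqOn_of_cexp_eq isPreconnected_imagAxis continuous_logLambda.continuousOn ?_ ?_ I_re ?_
    · intro σ hσ
      have hpos := (modularLambda_eq_re_of_re_eq_zero hσ).2.1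
      have h1 : ContinuousAt (fun τ : ℍ => (modularLambda τ).re) σ :=
        (Complex.continuous_re.comp continuous_modularLambda).continuousAt
      have h2 : ContinuousAt (fun r : ℝ => ((Real.log r : ℝ) : ℂ)) ((modularLambda σ).re) :=
        Complex.continuous_ofReal.continuousAt.comp (Real.continuousAt_log hpos.ne')
      have h3 := ContinuousAt.comp (g := fun r : ℝ => ((Real.log r : ℝ) : ℂ))
        (f := fun τ : ℍ => (modularLambda τ).re) h2 h1
      exact h3.continuousWithinAt
    · intro σ hσ
      obtain ⟨hre, hpos, -⟩ := modularLambda_eq_re_of_re_eq_zero hσ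
      rw [cexp_logLambda, ← Complex.ofReal_exp, Real.exp_log hpos, ← hre]
    · rw [logLambda_I, modularLambda_I]
      norm_num
  exact key h

/-- **`𝓛_S(it) = log(1 − λ(it))`** for `t > 0`. [cite: CohnEtAl2019, §2.1.3] -/
theorem logLambdaS_of_re_eq_zero {τ : ℍ} (h : τ.re = 0) :
    logLambdaS τ = (Real.log (1 - (modularLambda τ).re) : ℝ) := by
  have key : Set.EqOn logLambdaS (fun τ => ((Real.log (1 - (modularLambda τ).re) : ℝ) : ℂ))
      {τ : ℍ | τ.re = 0} := by
    refine eqOn_of_cexp_eq isPreconnected_imagAxis continuous_logLambdaS.continuousOn ?_ ?_ I_re ?_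
    · intro σ hσ
      have hlt := (modularLambda_eq_re_of_re_eq_zero hσ).2.2
      have hpos : 0 < 1 - (modularLambda σ).re := by linarith
      have h1 : ContinuousAt (fun τ : ℍ => 1 - (modularLambda τ).re) σ :=
        (continuous_const.sub (Complex.continuous_re.comp continuous_modularLambda)).continuousAt
      have h2 : ContinuousAt (fun r : ℝ => ((Real.log r : ℝ) : ℂ)) (1 - (modularLambda σ).re) :=
        Complex.continuous_ofReal.continuousAt.comp (Real.continuousAt_log hpos.ne')
      have h3 := ContinuousAt.comp (g := fun r : ℝ => ((Real.log r : ℝ) : ℂ))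
        (f := fun τ : ℍ => 1 - (modularLambda τ).re) h2 h1
      exact h3.continuousWithinAt
    · intro σ hσ
      obtain ⟨hre, -, hlt⟩ := modularLambda_eq_re_of_re_eq_zero hσ
      have hpos : 0 < 1 - (modularLambda σ).re := by linarith
      rw [cexp_logLambdaS, ← Complex.ofReal_exp, Real.exp_log hpos, Complex.ofReal_sub,
        Complex.ofReal_one, ← hre]
    · rw [logLambdaS_I, modularLambda_I]
      norm_num
  exact key h

/-! ## The laws under `S` -/

/-- `τ ↦ S • τ = −1/τ` is continuous on `ℍ`. [folklore] -/
theorem continuous_S_smul : Continuous fun τ : ℍ => ModularGroup.S • τ := by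
  rw [isEmbedding_coe.continuous_iff]
  have : ((↑) : ℍ → ℂ) ∘ (fun τ : ℍ => ModularGroup.S • τ) = fun τ : ℍ => -(τ : ℂ)⁻¹ := by
    funext τ
    rw [Function.comp_apply, modular_S_smul, UpperHalfPlane.coe_mk, inv_neg]
  rw [this]
  exact (continuous_coe.inv₀ fun τ => τ.ne_zero).neg

/-- `S • S • τ = τ`. [folklore] -/
theorem S_smul_S_smul (τ : ℍ) : ModularGroup.S • ModularGroup.S • τ = τ := by
  apply UpperHalfPlane.ext
  rw [modular_S_smul, UpperHalfPlane.coe_mk, modular_S_smul, UpperHalfPlane.coe_mk, inv_neg, inv_inv,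
    neg_neg]

/-- `λ(S • τ) = 1 − λ(τ)` (CKMRV (2.8): `λ_S(z) = λ(−1/z) = 1 − λ(z)`). [cite: CohnEtAl2019, §2.1.3 (2.8)] -/
theorem modularLambda_S_smul (τ : ℍ) : modularLambda (ModularGroup.S • τ) = 1 - modularLambda τ := by
  rw [modular_S_smul]
  exact modularLambda_neg_inv τ

/-- **`𝓛|₀S = 𝓛_S`**: `𝓛(−1/τ) = 𝓛_S(τ)` (both are continuous logarithms of `1 − λ` on the
connected `ℍ` agreeing at `τ = i`). [cite: CohnEtAl2019, §2.1.3 (2.11)] -/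
theorem logLambda_S_smul (τ : ℍ) : logLambda (ModularGroup.S • τ) = logLambdaS τ := by
  have key : Set.EqOn (fun τ => logLambda (ModularGroup.S • τ)) logLambdaS Set.univ := by
    refine eqOn_of_cexp_eq isPreconnected_univ
      (continuous_logLambda.comp continuous_S_smul).continuousOn
      continuous_logLambdaS.continuousOn (fun σ _ => ?_) (Set.mem_univ UpperHalfPlane.I) ?_
    · show cexp (logLambda (ModularGroup.S • σ)) = cexp (logLambdaS σ)
      rw [cexp_logLambda, cexp_logLambdaS, modularLambda_S_smul]
    · show logLambda (ModularGroup.S • UpperHalfPlane.I) = logLambdaS UpperHalfPlane.I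
      have hSI : ModularGroup.S • UpperHalfPlane.I = UpperHalfPlane.I := by
        rw [modular_S_smul]; apply UpperHalfPlane.ext; simp
      rw [hSI, logLambda_I, logLambdaS_I]
  exact key (Set.mem_univ τ)

/-- **`𝓛_S|₀S = 𝓛`**: `𝓛_S(−1/τ) = 𝓛(τ)`. [cite: CohnEtAl2019, §2.1.3 (2.11)] -/
theorem logLambdaS_S_smul (τ : ℍ) : logLambdaS (ModularGroup.S • τ) = logLambda τ := by
  rw [← logLambda_S_smul, S_smul_S_smul]

/-! ## Behaviour as `Im τ → ∞` -/

/-- Real translations preserve `Im τ → ∞`. [folklore] -/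
theorem tendsto_vadd_atImInfty (x : ℝ) : Tendsto (fun τ : ℍ => x +ᵥ τ) atImInfty atImInfty := by
  simp only [atImInfty, tendsto_comap_iff]
  have : UpperHalfPlane.im ∘ (fun τ : ℍ => x +ᵥ τ) = UpperHalfPlane.im := by
    funext τ; simp
  rw [this]
  exact tendsto_comap

/-- `λ(τ) → 0` as `Im τ → ∞`. [folklore] -/
theorem tendsto_modularLambda_atImInfty : Tendsto modularLambda atImInfty (𝓝 0) := by
  have := tendsto_thetaV.div tendsto_thetaU one_ne_zero
  rw [zero_div] at this
  exact this

/-- `e^{−πiτ} λ(τ) → 16` as `Im τ → ∞` (`λ = 16 q^{1/2} + ⋯`). [folklore] -/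
theorem tendsto_exp_mul_modularLambda_atImInfty :
    Tendsto (fun τ : ℍ => cexp (-(π * I * τ)) * modularLambda τ) atImInfty (𝓝 16) := by
  have := tendsto_exp_mul_thetaV.div tendsto_thetaU one_ne_zero
  rw [div_one] at this
  refine this.congr fun τ => ?_
  simp only [modularLambda, Pi.div_apply]
  ring

/-- The filter `atImInfty` on `ℍ` is nontrivial. [folklore] -/
theorem atImInfty_neBot : (atImInfty : Filter ℍ).NeBot := by
  rw [atImInfty, comap_neBot_iff]
  intro t ht
  obtain ⟨A, hA⟩ := mem_atTop_sets.1 ht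
  refine ⟨mkI (max A 1) (lt_max_of_lt_right one_pos), hA _ ?_⟩
  rw [mkI_im]; exact le_max_left _ _

/-- **Normalised logarithms tend to the logarithm of the limit**: if `e^L = G` on `ℍ` with `L`,
`G` continuous, `L(it) = log G(it)` is the real logarithm of the positive real `G(it)` for all
`t > 0`, and `G → c > 0` as `Im τ → ∞`, then `L → log c`. (Near `i∞` the function `L` and the
principal branch `log ∘ G` are continuous logarithms of `G` on a connected half-plane and agree on
the imaginary axis.) [folklore] -/
theorem tendsto_of_cexp_eq {L G : ℍ → ℂ} (hL : Continuous L) (hG : Continuous G)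
    (he : ∀ τ, cexp (L τ) = G τ) {c : ℝ} (hc : 0 < c) (hlim : Tendsto G atImInfty (𝓝 (c : ℂ)))
    (haxis : ∀ (t : ℝ) (ht : 0 < t), (G (mkI t ht)).im = 0 ∧ 0 < (G (mkI t ht)).re ∧
      L (mkI t ht) = (Real.log (G (mkI t ht)).re : ℝ)) :
    Tendsto L atImInfty (𝓝 ((Real.log c : ℝ) : ℂ)) := by
  -- eventually `G` is within `c/2` of `c`, hence in the slit plane
  have hball : ∀ᶠ τ in atImInfty, ‖G τ - c‖ < c / 2 := by
    have := hlim (Metric.ball_mem_nhds (c : ℂ) (half_pos hc))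
    filter_upwards [this] with τ hτ using by simpa [dist_eq_norm] using hτ
  obtain ⟨T₁, hT₁⟩ := (atImInfty_mem _).1 hball
  set T : ℝ := max T₁ 1 with hT
  have hTpos : 0 < T := lt_of_lt_of_le one_pos (le_max_right _ _)
  have hslit : ∀ τ : ℍ, T ≤ τ.im → G τ ∈ slitPlane := fun τ hτ => by
    have h : ‖G τ - c‖ < c / 2 := hT₁ τ ((le_max_left _ _).trans hτ)
    have hre : c / 2 < (G τ).re := by
      have h1 : |(G τ - c).re| < c / 2 := (abs_re_le_norm _).trans_lt h
      rw [sub_re, ofReal_re] at h1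
      linarith [neg_abs_le ((G τ).re - c)]
    exact mem_slitPlane_iff.2 (Or.inl (by linarith))
  -- `L = log ∘ G` on the half-plane `Im ≥ T`
  have hEq : Set.EqOn L (fun τ => Complex.log (G τ)) {τ : ℍ | T ≤ τ.im} := by
    refine eqOn_of_cexp_eq (isPreconnected_setOf_le_im T) hL.continuousOn ?_ ?_
      (show mkI T hTpos ∈ {τ : ℍ | T ≤ τ.im} by simp) ?_
    · intro τ hτ
      exact ((continuousAt_clog (hslit τ hτ)).comp hG.continuousAt).continuousWithinAt
    · intro τ hτ
      rw [he, Complex.exp_log]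
      rw [← he]; exact Complex.exp_ne_zero _
    · obtain ⟨him, hre, hLt⟩ := haxis T hTpos
      have hG' : G (mkI T hTpos) = ((G (mkI T hTpos)).re : ℂ) :=
        Complex.ext (by simp) (by simp [him])
      rw [hLt]
      conv_rhs => rw [hG']
      exact Complex.ofReal_log hre.le
  -- conclude
  have hlog : Tendsto (fun τ => Complex.log (G τ)) atImInfty (𝓝 ((Real.log c : ℝ) : ℂ)) := by
    rw [Complex.ofReal_log hc.le]
    exact ((continuousAt_clog (mem_slitPlane_iff.2 (Or.inl (by simpa using hc)))).tendsto).comp hlim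
  refine hlog.congr' ?_
  rw [EventuallyEq, eventually_iff_exists_mem]
  exact ⟨{τ : ℍ | T ≤ τ.im}, (atImInfty_mem _).2 ⟨T, fun τ hτ => hτ⟩, fun τ hτ => (hEq hτ).symm⟩

/-- **`𝓛_S(τ) → 0` as `Im τ → ∞`** (uniformly in `Re τ`; CKMRV (2.10): `𝓛_S = −16q^{1/2} + ⋯`).
[cite: CohnEtAl2019, §2.1.3 (2.10)] -/
theorem tendsto_logLambdaS_atImInfty : Tendsto logLambdaS atImInfty (𝓝 0) := by
  have h := tendsto_of_cexp_eq (G := fun τ => 1 - modularLambda τ) continuous_logLambdaS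
    (continuous_const.sub continuous_modularLambda) cexp_logLambdaS one_pos
    (by simpa using (tendsto_const_nhds (x := (1 : ℂ))).sub tendsto_modularLambda_atImInfty) ?_
  · simpa using h
  · intro t ht
    obtain ⟨hre, hpos, hlt⟩ := modularLambda_eq_re_of_re_eq_zero (mkI_re t ht)
    refine ⟨?_, ?_, ?_⟩
    · rw [sub_im, one_im, hre, ofReal_im, sub_zero]
    · rw [sub_re, one_re, hre, ofReal_re]; linarith
    · rw [logLambdaS_of_re_eq_zero (mkI_re t ht), sub_re, one_re]

/-- **`𝓛(τ) − πiτ → log 16` as `Im τ → ∞`** (uniformly in `Re τ`; CKMRV (2.10):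
`𝓛 = πiz + 4 log 2 − 8q^{1/2} + O(q)`). [cite: CohnEtAl2019, §2.1.3 (2.10)] -/
theorem tendsto_logLambda_sub_atImInfty :
    Tendsto (fun τ : ℍ => logLambda τ - π * I * τ) atImInfty (𝓝 ((Real.log 16 : ℝ) : ℂ)) := by
  have hc1 := continuous_logLambda
  have hc2 := continuous_modularLambda
  have hc3 : Continuous fun τ : ℍ => (τ : ℂ) := continuous_coe
  refine tendsto_of_cexp_eq (L := fun τ : ℍ => logLambda τ - π * I * τ)
    (G := fun τ => cexp (-(π * I * τ)) * modularLambda τ) (by fun_prop) (by fun_prop) (fun τ => ?_)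
    (by norm_num) (by simpa using tendsto_exp_mul_modularLambda_atImInfty) ?_
  · show cexp (logLambda τ - π * I * τ) = cexp (-(π * I * τ)) * modularLambda τ
    rw [sub_eq_add_neg, Complex.exp_add, cexp_logLambda]; ring
  · intro t ht
    obtain ⟨hre, hpos, hlt⟩ := modularLambda_eq_re_of_re_eq_zero (mkI_re t ht)
    have hexp : cexp (-(π * I * (mkI t ht : ℂ))) = ((Real.exp (π * t) : ℝ) : ℂ) := by
      rw [coe_mkI, Complex.ofReal_exp]
      congr 1
      push_cast
      ring_nf
      rw [I_sq]; ring
    have hG : cexp (-(π * I * (mkI t ht : ℂ))) * modularLambda (mkI t ht) =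
        ((Real.exp (π * t) * (modularLambda (mkI t ht)).re : ℝ) : ℂ) := by
      rw [hexp]; conv_lhs => rw [hre]
      push_cast; ring
    refine ⟨?_, ?_, ?_⟩
    · rw [hG, ofReal_im]
    · rw [hG, ofReal_re]; exact mul_pos (Real.exp_pos _) hpos
    · show logLambda (mkI t ht) - π * I * (mkI t ht : ℂ) = _
      rw [hG, ofReal_re, Real.log_mul (Real.exp_pos _).ne' hpos.ne', Real.log_exp,
        logLambda_of_re_eq_zero (mkI_re t ht), coe_mkI]
      push_cast
      ring_nf
      rw [I_sq]; ring

/-! ## The laws under `T` -/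

/-- Real translations are continuous on `ℍ`. [folklore] -/
theorem continuous_real_vadd (x : ℝ) : Continuous fun τ : ℍ => x +ᵥ τ := by
  rw [isEmbedding_coe.continuous_iff]
  have : ((↑) : ℍ → ℂ) ∘ (fun τ : ℍ => x +ᵥ τ) = fun τ : ℍ => (x : ℂ) + τ := by
    funext τ; rw [Function.comp_apply, coe_vadd]
  rw [this]
  exact continuous_const.add continuous_coe

/-- A continuous function on `ℍ` with `e^{E} = 1` tending to `0` at `i∞` vanishes. [folklore] -/
theorem eq_zero_of_cexp_eq_one {E : ℍ → ℂ} (hE : Continuous E) (he : ∀ τ, cexp (E τ) = 1)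
    (hlim : Tendsto E atImInfty (𝓝 0)) : E = 0 := by
  -- `E` is constant
  have hconst : Set.EqOn E (fun _ => E UpperHalfPlane.I) Set.univ :=
    eqOn_of_cexp_eq isPreconnected_univ hE.continuousOn continuousOn_const
      (fun τ _ => by rw [he, he]) (Set.mem_univ UpperHalfPlane.I) rfl
  have hE' : E = fun _ => E UpperHalfPlane.I := funext fun τ => hconst (Set.mem_univ τ)
  rw [hE'] at hlim ⊢
  have := atImInfty_neBot
  have h0 : E UpperHalfPlane.I = 0 := tendsto_nhds_unique tendsto_const_nhds hlim
  funext τ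
  simp [h0]

/-- `λ(τ + 1) = λ(τ)/(λ(τ) − 1)` with `λ(τ) ≠ 1`. [cite: CohnEtAl2019, §2.1.3 (2.9)] -/
theorem modularLambda_vadd_one_sub_one_ne (τ : ℍ) : modularLambda τ - 1 ≠ 0 :=
  sub_ne_zero.2 (modularLambda_ne_one τ)

/-- **`𝓛_S|₀T = −𝓛_S`**: `𝓛_S(τ + 1) = −𝓛_S(τ)` (from `λ_S(z+1) = 1/λ_S(z)`; the constant of
integration vanishes since both sides tend to `0` at `i∞`). [cite: CohnEtAl2019, §2.1.3 (2.11)] -/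
theorem logLambdaS_vadd_one (τ : ℍ) : logLambdaS ((1 : ℝ) +ᵥ τ) = -logLambdaS τ := by
  have hc1 := continuous_logLambdaS
  have hc2 := continuous_real_vadd (1 : ℝ)
  have h := eq_zero_of_cexp_eq_one (E := fun τ => logLambdaS ((1 : ℝ) +ᵥ τ) + logLambdaS τ)
    (by fun_prop) (fun σ => ?_) ?_
  · have := congrFun h τ
    simp only [Pi.zero_apply] at this
    linear_combination this
  · rw [Complex.exp_add, cexp_logLambdaS, cexp_logLambdaS, modularLambda_vadd_one']
    have h1 := modularLambda_vadd_one_sub_one_ne σ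
    field_simp
    ring
  · have := (tendsto_logLambdaS_atImInfty.comp (tendsto_vadd_atImInfty 1)).add
      tendsto_logLambdaS_atImInfty
    rw [add_zero] at this
    exact this

/-- **`𝓛|₀T = 𝓛 − 𝓛_S + iπ`**: `𝓛(τ + 1) = 𝓛(τ) − 𝓛_S(τ) + πi` (from
`λ(z+1) = −λ(z)/λ_S(z)`; the constant is fixed by the limits `𝓛 − πiτ → log 16`, `𝓛_S → 0` at
`i∞`). [cite: CohnEtAl2019, §2.1.3 (2.11)] -/
theorem logLambda_vadd_one (τ : ℍ) :
    logLambda ((1 : ℝ) +ᵥ τ) = logLambda τ - logLambdaS τ + π * I := by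
  have hc1 := continuous_logLambdaS
  have hc1' := continuous_logLambda
  have hc2 := continuous_real_vadd (1 : ℝ)
  have h := eq_zero_of_cexp_eq_one
    (E := fun τ => logLambda ((1 : ℝ) +ᵥ τ) - logLambda τ + logLambdaS τ - π * I)
    (by fun_prop) (fun σ => ?_) ?_
  · have := congrFun h τ
    simp only [Pi.zero_apply] at this
    linear_combination this
  · rw [Complex.exp_sub, Complex.exp_add, Complex.exp_sub, cexp_logLambda, cexp_logLambda,
      cexp_logLambdaS, modularLambda_vadd_one', Complex.exp_pi_mul_I]
    have h1 := modularLambda_vadd_one_sub_one_ne σ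
    have h2 := modularLambda_ne_zero σ
    field_simp
    ring
  · -- `E(τ) = M(τ+1) − M(τ) + 𝓛_S(τ)` with `M(τ) = 𝓛(τ) − πiτ → log 16`
    have hM := tendsto_logLambda_sub_atImInfty
    have := ((hM.comp (tendsto_vadd_atImInfty 1)).sub hM).add tendsto_logLambdaS_atImInfty
    rw [sub_self, zero_add] at this
    refine this.congr fun σ => ?_
    simp only [Function.comp_apply, coe_vadd, ofReal_one]
    ring

/-! ## Slash-operator form of the four laws (weight `0`) -/

/-- Weight-`0` slash by `T` is translation. [folklore] -/
theorem slash_zero_T_apply (f : ℍ → ℂ) (τ : ℍ) : (f ∣[(0 : ℤ)] ModularGroup.T) τ = f ((1 : ℝ) +ᵥ τ) := by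
  rw [SL_slash_apply, modular_T_smul, neg_zero, zpow_zero, mul_one]

/-- Weight-`0` slash by `S` is `τ ↦ −1/τ`. [folklore] -/
theorem slash_zero_S_apply (f : ℍ → ℂ) (τ : ℍ) :
    (f ∣[(0 : ℤ)] ModularGroup.S) τ = f (ModularGroup.S • τ) := by
  rw [SL_slash_apply, neg_zero, zpow_zero, mul_one]

/-- **(2.11), first law: `𝓛|₀T = 𝓛 − 𝓛_S + iπ`.** [cite: CohnEtAl2019, §2.1.3 (2.11)] -/
theorem logLambda_slash_T :
    logLambda ∣[(0 : ℤ)] ModularGroup.T = logLambda - logLambdaS + fun _ => π * I := by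
  funext τ
  rw [slash_zero_T_apply, logLambda_vadd_one]
  rfl

/-- **(2.11), second law: `𝓛_S|₀T = −𝓛_S`.** [cite: CohnEtAl2019, §2.1.3 (2.11)] -/
theorem logLambdaS_slash_T : logLambdaS ∣[(0 : ℤ)] ModularGroup.T = -logLambdaS := by
  funext τ
  rw [slash_zero_T_apply, logLambdaS_vadd_one]
  rfl

/-- **(2.11), third law: `𝓛|₀S = 𝓛_S`.** [cite: CohnEtAl2019, §2.1.3 (2.11)] -/
theorem logLambda_slash_S : logLambda ∣[(0 : ℤ)] ModularGroup.S = logLambdaS := by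
  funext τ
  rw [slash_zero_S_apply, logLambda_S_smul]

/-- **(2.11), fourth law: `𝓛_S|₀S = 𝓛`.** [cite: CohnEtAl2019, §2.1.3 (2.11)] -/
theorem logLambdaS_slash_S : logLambdaS ∣[(0 : ℤ)] ModularGroup.S = logLambda := by
  funext τ
  rw [slash_zero_S_apply, logLambdaS_S_smul]

end Literature.NumberTheory.ModularForms
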